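import Summits.HodgeConjecture.HodgeConjecture.Theorems.SignSymmetricPowersFourFactsTorus
import Summits.HodgeConjecture.HodgeConjecture.Theorems.SignSymmetricPowersSignThreefoldPowersHodge
import Summits.HodgeConjecture.HodgeConjecture.Theorems.SmoothHypersurfaceGeometricGenus
import Literature.AlgebraicGeometry.HodgeTheory.SymmetricA3BifurcationTheorem
import HarnessLib

/-!
# Crux K1-B `VeryGeneralSignCommutatorsInHg` (route `SignSymmetricPowers`, stmt-HodgeConjecture-19716) and the rung leaf
# `SignThreefoldPowersHodge` modulo {hPL, hCDK, hB2-PL}: the bifurcation half of the binder hB2 DISCHARGED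

Prover seat `hodge-nonav-19716-p2` (g8), cell `hodge-nonav`.  Landed `--supports stmt-HodgeConjecture-19716` (helper);
sorry-free, no definition, no new named fact.  CONDITIONAL results; nothing here says HC ∕ HC_AV is proved; rung F-H1 is
not moved.

THE RE-CUT.  In registry v17 (`{hPL, hCDK, hB2}`, 19716-p2 g7 for P3 g32) the binder
hB2 = `Literature.AlgebraicGeometry.HodgeTheory.picardLefschetz_symmetricA3` asserts (i) the BIFURCATION picture of the
symmetric two-parameter unfolding of an `A₃` point (AGZV II §5.2, boundary singularity `B₂`) and (ii) the Picard–Lefschetz data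
along its two circles.  Programme B2-BIF of the cell (prover-Bx g12 + 19716-p2 g8) PROVED (i):
`IsSymmetricA3Datum.exists_isSymmetricA3Bifurcation` (`Literature/AlgebraicGeometry/HodgeTheory/SymmetricA3BifurcationTheorem`),
whence `IsSymmetricA3Datum.picardLefschetz_symmetricA3_of_PL`: hB2 follows from its Picard–Lefschetz half hB2-PL alone
(«for every symmetric `A₃` datum and every bifurcation datum `(εa, εb, ψ)` of it, the clauses (ii) —
`SymmetricA3PicardLefschetzClauses` — for the same `ψ` on some radius `0 < εa' ≤ εa`», stated INLINE, not a new named fact).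
This file re-runs p638523's composition with hB2-PL in the hB2 slot:

* `veryGeneralSignCommutatorsInHg_of_three_facts_PL (hPL) (hCDK) (hPL3)` — K1-B ⟸ {hPL, hCDK, hB2-PL}
  (hpg3 being the landed `SmoothHypersurfaceGeometricGenus.stub_genusBoundThreefold`);
* `signThreefoldPowersHodge_of_three_facts_PL` — the rung-F-H1 leaf likewise.

Registry consequence (P3): 19716 v18 = {hPL, hCDK, hB2-PL}.
-/

set_option linter.dupNamespace false

namespace Summit.HodgeConjecture.HodgeConjecture.Theorems.SignSymmetricPowersK1BOfPL

open Literature.AlgebraicGeometry.HodgeTheory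

/-- **Crux K1-B modulo {hPL, hCDK, hB2-PL}.**  The very general member of the `ι`-even family has its sign commutators
in the Hodge group, GRANTED the uniform nodal Picard–Lefschetz package hPL, Cattani–Deligne–Kaplan hCDK, and the
Picard–Lefschetz half hB2-PL of F-B2PL (the bifurcation half being the theorem
`IsSymmetricA3Datum.exists_isSymmetricA3Bifurcation`). -/
theorem veryGeneralSignCommutatorsInHg_of_three_facts_PL
    (hPL : Literature.AlgebraicGeometry.HodgeTheory.picardLefschetz_nodalForms_uniform)
    (hCDK : Literature.AlgebraicGeometry.HodgeTheory.cmsp_nonHodgeGenericPoints_countable_algebraic_cover)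
    (hPL3 : ∀ (n d : ℕ) (f₁ g₀ g₂ : MvPolynomial (Fin (n + 2)) ℂ) (j k : Fin (n + 2)) (a : Fin (n + 2) → ℂˣ),
      f₁.IsHomogeneous d → g₀.IsHomogeneous d → g₂.IsHomogeneous d → IsSymmetricA3Datum f₁ g₀ g₂ j k a →
      ∀ (εa εb : ℝ) (ψ : ℂ → ℂ), IsSymmetricA3Bifurcation f₁ g₀ g₂ j a εa εb ψ →
        ∃ εa' : ℝ, 0 < εa' ∧ εa' ≤ εa ∧ SymmetricA3PicardLefschetzClauses n d f₁ g₀ g₂ ψ εa') :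
    Summit.HodgeConjecture.HodgeConjecture.Theses.SignSymmetricPowers.VeryGeneralSignCommutatorsInHg :=
  SignSymmetricPowersFourFactsTorus.veryGeneralSignCommutatorsInHg_of_genusBound_three_facts
    SmoothHypersurfaceGeometricGenus.stub_genusBoundThreefold @hPL @hCDK
    (IsSymmetricA3Datum.picardLefschetz_symmetricA3_of_PL hPL3)

/-- **The rung-F-H1 leaf `SignThreefoldPowersHodge` modulo {hPL, hCDK, hB2-PL}** (HC for all powers of the very general
`ι`-even threefold), by `signThreefoldPowersHodge_of_veryGeneralSignCommutatorsInHg`. -/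
theorem signThreefoldPowersHodge_of_three_facts_PL
    (hPL : Literature.AlgebraicGeometry.HodgeTheory.picardLefschetz_nodalForms_uniform)
    (hCDK : Literature.AlgebraicGeometry.HodgeTheory.cmsp_nonHodgeGenericPoints_countable_algebraic_cover)
    (hPL3 : ∀ (n d : ℕ) (f₁ g₀ g₂ : MvPolynomial (Fin (n + 2)) ℂ) (j k : Fin (n + 2)) (a : Fin (n + 2) → ℂˣ),
      f₁.IsHomogeneous d → g₀.IsHomogeneous d → g₂.IsHomogeneous d → IsSymmetricA3Datum f₁ g₀ g₂ j k a →
      ∀ (εa εb : ℝ) (ψ : ℂ → ℂ), IsSymmetricA3Bifurcation f₁ g₀ g₂ j a εa εb ψ →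
        ∃ εa' : ℝ, 0 < εa' ∧ εa' ≤ εa ∧ SymmetricA3PicardLefschetzClauses n d f₁ g₀ g₂ ψ εa') :
    Summit.HodgeConjecture.HodgeConjecture.Theses.SignSymmetricPowers.SignThreefoldPowersHodge :=
  SignSymmetricPowersSignThreefoldPowersHodge.signThreefoldPowersHodge_of_veryGeneralSignCommutatorsInHg
    (veryGeneralSignCommutatorsInHg_of_three_facts_PL @hPL @hCDK @hPL3)

end Summit.HodgeConjecture.HodgeConjecture.Theorems.SignSymmetricPowersK1BOfPL
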